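import Literature.AlgebraicGeometry.Frobenioids.Isotropification
import Literature.AlgebraicGeometry.Frobenioids.RigiditySlimness
import Literature.AlgebraicGeometry.Frobenioids.IstrStandardTypeProofs
import Literature.AlgebraicGeometry.Frobenioids.EquivalenceFrobeniusQuasiIsotropic
import Literature.AlgebraicGeometry.Frobenioids.BaseCategoryTheoreticity
import Mathlib.CategoryTheory.Adjunction.Unique
import Mathlib.CategoryTheory.ObjectProperty.Equivalence
import HarnessLib

/-!
# Frobenioids I, §3: Theorem 3.4 (i), diagram part — the `1`-unique `Ψ^istr` square and the rigidity
# of its composite functors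

Mochizuki, *The geometry of Frobenioids I: the general theory*, Kyushu J. Math. **62** (2008),
Thm. 3.4 (i), kurims p. 62: "Moreover, there exists a `1`-unique functor `Ψ^istr : C₁^istr → C₂^istr`
that fits into a `1`-commutative diagram [with the isotropification functors of Prop. 1.9 (v) as
vertical arrows; the horizontal arrows are equivalences of categories]. Finally, if `D₁`, `D₂` are slim,
and `C₁`, `C₂` are of Frobenius-normalized type, then each of the composite functors of this diagram is
rigid"; proof p. 63: "the remainder of assertion (i) follows formally from [the definitions and]
Proposition 1.9, (v), (vi), (vii). The final statement concerning the rigidity of the composite functors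
may be verified as follows: By Proposition 1.13, (ii), it suffices to show, for each `A ∈ Ob(C^istr)`
that the automorphism `α ∈ O^×(A)` induced by an automorphism `∈ Aut(C₁ → C₁^istr)` is trivial. But,
by Definition 1.3, (i), (a), (b); (iii), (c), it suffices to show this when `A` is Frobenius-trivial, in
which case the triviality of `α` follows from the functoriality of `α` with respect to base-identity
endomorphisms of `A` of arbitrary of Frobenius degree [which implies, since `C₁`, `C₂` are of
Frobenius-normalized type, that `α^d = α`, for all `d ∈ ℕ≥1`, hence that `α` is trivial, as desired]."
[cite: MochizukiFrdI2008, Thm. 3.4 (i) p.62]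

PROOF-ONLY companion (abc-iut cell, WAVE-4 discharge prover abc-iut-w4-d088; node `FrdI:Thm3.4(i)`,
whose PRESERVATION part is abc-iut-L1-t13's `FrdI.Thm34i_holds`) of the typed diagram part
`PreFrobenioidData.Thm34i_istr` (`BaseCategoryTheoreticity.lean`, abc-iut-L1-t3), instantiated at the
operations `PreFrobenioidData.ofFunctor Φ_i F_i` and at the REAL isotropification functors of
Prop. 1.9 (v) (`PreFrobenioid.isotropification`, abc-iut-L1-t1's `Isotropification.lean`), read in the
§3 full subcategory `(ofFunctor Φ F).Istr` through the identity-on-objects comparison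
`ObjectProperty.ιOfLE` (the two full subcategories `C^istr` are cut out by propositionally equal object
properties, `isotropicObjects_le_ofFunctor` / `isotropicObjects_ofFunctor_le`). Route:
* rigidity of the isotropification functor `C → C^istr` over a slim base for `C` of
  Frobenius-normalized type (`PreFrobenioid.isRigidFunctor_isotropification`): an automorphism of
  `C → C^istr` induces, through `F ≅ (C → C^istr → F_Φ)` (Prop. 1.9 (v)), an automorphism of the rigid
  functor `C → F_Φ` (Prop. 1.13 (i) over a slim base, abc-iut-L1-t1 `isRigidFunctor_functor`), so its
  components lie in `O^×`; they are trivial at Frobenius-trivial objects by Frobenius-normalization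
  (`α² = α`), hence everywhere (Def. 1.3 (i)(a)(b): pre-steps are monomorphisms, all arrows are
  epimorphisms);
* `Ψ^istr :=` the restriction of `Ψ` to `C^istr` (Thm. 3.4 (i): `Ψ` preserves isotropic objects,
  abc-iut-L1-t13 `isotropicObjects_inverseImage`); `1`-commutativity by uniqueness of left adjoints
  (Prop. 1.9 (v): isotropification ⊣ inclusion; the two right adjoints `C₂^istr → C₁` coincide);
  `1`-uniqueness from "the restriction of the isotropification functor to `C^istr` is isomorphic to the
  identity"; rigidity of the composites by transport along equivalences / fully faithful functors /
  isomorphisms of functors.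
No statement of the paper is restated or strengthened; nothing here bears on [IUTchIII] Cor. 3.12.
-/

set_option backward.isDefEq.respectTransparency false

namespace Literature.AlgebraicGeometry.Frobenioids

open CategoryTheory Opposite

universe w v v' u u' v₁ v₂ v₃ u₁ u₂ u₃

/-! ### Rigid functors: transport along isomorphisms and fully faithful postcomposition -/

section Rigid

variable {P : Type u₁} [Category.{v₁} P] {Q : Type u₂} [Category.{v₂} Q] {Z : Type u₃} [Category.{v₃} Z]

/-- Rigidity is invariant under isomorphism of functors (conjugation identifies the automorphism
groups). [cite: MochizukiFrdI2008, §0 p.14] -/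
theorem IsRigidFunctor.of_iso {G G' : P ⥤ Q} (hG : IsRigidFunctor G) (e : G ≅ G') : IsRigidFunctor G' := by
  intro α
  have h := hG (e ≪≫ α ≪≫ e.symm)
  have : α = e.symm ≪≫ (e ≪≫ α ≪≫ e.symm) ≪≫ e := by
    ext X
    simp
  rw [this, h]
  ext X
  simp

/-- Postcomposing a rigid functor with a fully faithful functor yields a rigid functor (an automorphism
of `G ⋙ J` descends along `J`). [cite: MochizukiFrdI2008, §0 p.14] -/
theorem IsRigidFunctor.comp_fullyFaithful {G : P ⥤ Q} (hG : IsRigidFunctor G) (J : Q ⥤ Z) [J.Full]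
    [J.Faithful] : IsRigidFunctor (G ⋙ J) := by
  intro α
  let β : G ≅ G := NatIso.ofComponents (fun X => J.preimageIso (α.app X)) (by
    intro X Y f
    apply J.map_injective
    simpa using α.hom.naturality f)
  have hβ : β = Iso.refl G := hG β
  ext X
  have hX : β.hom.app X = 𝟙 (G.obj X) := by rw [hβ]; rfl
  have : α.hom.app X = J.map (β.hom.app X) := by simp [β]
  rw [this, hX, J.map_id]
  rfl

end Rigid

namespace PreFrobenioid

/-! ### Rigidity of the isotropification functor (proof of Thm. 3.4 (i), p. 63) -/

section One

variable {D : Type u} [Category.{v} D] {Φ : Dᵒᵖ ⥤ CommMonCat.{w}} {C : Type u'} [Category.{v'} C]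
  {F : C ⥤ ElemFrobenioid Φ}

/-- Step 1 ("By Proposition 1.13 … the automorphism `α ∈ O^×(A)` induced by an automorphism
`∈ Aut(C → C^istr)`"): over a SLIM base, every component of an automorphism of the isotropification
functor maps to the identity of `F_Φ` — it is a component of an automorphism of the rigid functor
`C → F_Φ` (Prop. 1.13 (i)), transported along `F ≅ (C → C^istr → F_Φ)` (Prop. 1.9 (v)).
[cite: MochizukiFrdI2008, Thm. 3.4 (i) p.63] -/
theorem map_app_eq_id_of_iso_isotropification (hF : IsFrobenioid F) (hD : IsSlim D)
    (α : isotropification hF ≅ isotropification hF) (A : C) :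
    (istrFunctor F).map (α.hom.app A) = 𝟙 ((istrFunctor F).obj ((isotropification hF).obj A)) := by
  -- the induced automorphism of `F`
  let e := isotropificationFactorsIso hF
  let γ : F ≅ F := e ≪≫ Functor.isoWhiskerRight α (istrFunctor F) ≪≫ e.symm
  have hγ : γ = Iso.refl F := isRigidFunctor_functor hF hD γ
  have hγA : e.hom.app A ≫ (istrFunctor F).map (α.hom.app A) ≫ e.inv.app A = 𝟙 (F.obj A) := by
    have := congrArg (fun i : F ≅ F => i.hom.app A) hγ
    simpa [γ, e] using this
  calc (istrFunctor F).map (α.hom.app A)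
      = (e.inv.app A ≫ e.hom.app A) ≫ (istrFunctor F).map (α.hom.app A) ≫ (e.inv.app A ≫ e.hom.app A) := by
        rw [Iso.inv_hom_id_app, Category.id_comp]
        exact (Category.comp_id _).symm
    _ = e.inv.app A ≫ (e.hom.app A ≫ (istrFunctor F).map (α.hom.app A) ≫ e.inv.app A) ≫ e.hom.app A := by
        simp only [Category.assoc]
    _ = 𝟙 _ := by rw [hγA, Category.id_comp, Iso.inv_hom_id_app]

/-- Step 1, unpacked: the component at `A` of an automorphism of `C → C^istr` is a base-identity
endomorphism of `A^istr` of Frobenius degree `1`, i.e. lies in `O^▷(A^istr)` (indeed in `O^×`).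
[cite: MochizukiFrdI2008, Thm. 3.4 (i) p.63] -/
theorem app_mem_endSubmonoid_of_iso_isotropification (hF : IsFrobenioid F) (hD : IsSlim D)
    (α : isotropification hF ≅ isotropification hF) (A : C) :
    (α.hom.app A).hom ∈ (PreFrobenioidData.ofFunctor Φ F).endSubmonoid ((isotropification hF).obj A).obj := by
  have h := map_app_eq_id_of_iso_isotropification hF hD α A
  have hb : Base (istrFunctor F) (α.hom.app A) = 𝟙 _ := by
    change ElemFrobenioid.Base ((istrFunctor F).map (α.hom.app A)) = _
    rw [h]; rfl
  have hd : degFr (istrFunctor F) (α.hom.app A) = 1 := by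
    change ElemFrobenioid.degFr ((istrFunctor F).map (α.hom.app A)) = _
    rw [h]; rfl
  exact ⟨hb, hd⟩

/-- Transfer along an arrow: all arrows of `C` (hence of `C^istr`) are epimorphisms, so `α_A = 𝟙` forces
`α_B = 𝟙` for every `f : A ⟶ B`. [cite: MochizukiFrdI2008, Thm. 3.4 (i) p.63] -/
theorem app_eq_id_of_hom_of_iso_isotropification (hF : IsFrobenioid F)
    (α : isotropification hF ≅ isotropification hF) {A B : C} (f : A ⟶ B)
    (hA : α.hom.app A = 𝟙 _) : α.hom.app B = 𝟙 _ := by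
  have h := α.hom.naturality f
  rw [hA, Category.id_comp] at h
  haveI : Epi (hullMor hF f) := hF.isPreFrobenioid.isTotallyEpimorphic.epi _
  haveI : Epi ((isotropification hF).map f) :=
    (isotropicObjects F).ι.epi_of_epi_map (show Epi (hullMor hF f) from inferInstance)
  exact (cancel_epi ((isotropification hF).map f)).1 (h.trans (Category.comp_id _).symm)

/-- Transfer against a pre-step: pre-steps are monomorphisms (Def. 1.3 (v)(a)) and `f^istr` of a pre-step
is a pre-step, so `α_B = 𝟙` forces `α_A = 𝟙` for a pre-step `f : A ⟶ B`.
[cite: MochizukiFrdI2008, Thm. 3.4 (i) p.63] -/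
theorem app_eq_id_of_isPreStep_of_iso_isotropification (hF : IsFrobenioid F)
    (α : isotropification hF ≅ isotropification hF) {A B : C} {f : A ⟶ B} (hf : IsPreStep F f)
    (hB : α.hom.app B = 𝟙 _) : α.hom.app A = 𝟙 _ := by
  have h := α.hom.naturality f
  rw [hB, Category.comp_id] at h
  haveI : Mono (hullMor hF f) := hF.v_a _ (isPreStep_hullMor hF f hf)
  haveI : Mono ((isotropification hF).map f) :=
    (isotropicObjects F).ι.mono_of_mono_map (show Mono (hullMor hF f) from inferInstance)
  exact (cancel_mono ((isotropification hF).map f)).1 (h.symm.trans (Category.id_comp _).symm)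

/-- Step 2, Frobenius-trivial case: at a Frobenius-trivial object `T` (of a Frobenioid of
Frobenius-normalized type over a slim base) the component of any automorphism of `C → C^istr` is
trivial — "the triviality of `α` follows from the functoriality of `α` with respect to base-identity
endomorphisms of `A` of arbitrary Frobenius degree [… `α^d = α` …]" (with `d = 2`).
[cite: MochizukiFrdI2008, Thm. 3.4 (i) p.63] -/
theorem app_eq_id_of_isFrobeniusTrivial_of_iso_isotropification (hF : IsFrobenioid F) (hD : IsSlim D)
    (hFN : (PreFrobenioidData.ofFunctor Φ F).IsOfFrobeniusNormalizedType)
    (α : isotropification hF ≅ isotropification hF) {T : C} (hT : IsFrobeniusTrivial F T) :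
    α.hom.app T = 𝟙 _ := by
  obtain ⟨ζ, hζ⟩ := hT
  obtain ⟨hdeg, hbi, -⟩ := hζ 2
  -- the base-identity endomorphism `φ := (ζ 2)^istr` of `T^istr`, of Frobenius degree `2`
  let X : Istr F := (isotropification hF).obj T
  let φ : End X.obj := ((isotropification hF).map (show T ⟶ T from ζ 2)).hom
  let a : End X.obj := (α.hom.app T).hom
  have hφbi : (PreFrobenioidData.ofFunctor Φ F).IsBaseIdentity φ :=
    isBaseIdentity_hullMor hF _ hbi
  have hφdeg : (PreFrobenioidData.ofFunctor Φ F).degFr φ = 2 := by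
    show degFr F (hullMor hF _) = 2
    rw [degFr_hullMor, hdeg]
  have ha : a ∈ (PreFrobenioidData.ofFunctor Φ F).endSubmonoid X.obj :=
    app_mem_endSubmonoid_of_iso_isotropification hF hD α T
  -- Frobenius normalization: `φ ≫ a² = a ≫ φ`; naturality: `φ ≫ a = a ≫ φ`
  have hFNT := hFN.obj X.obj φ hφbi a ha
  rw [hφdeg] at hFNT
  have hnat : φ ≫ a = a ≫ φ :=
    congrArg InducedCategory.Hom.hom (α.hom.naturality (show T ⟶ T from ζ 2))
  have h1 : φ ≫ (a ≫ a) = φ ≫ a := by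
    have : a ^ ((2 : ℕ+) : ℕ) * φ = φ * a := hFNT
    rw [show ((2 : ℕ+) : ℕ) = 2 from rfl, pow_two, End.mul_def, End.mul_def, End.mul_def] at this
    rw [this, hnat]
  haveI : Epi φ := hF.isPreFrobenioid.isTotallyEpimorphic.epi _
  have h2 : a ≫ a = a := (cancel_epi φ).1 h1
  haveI : IsIso a := (ObjectProperty.isIso_hom_iff (α.hom.app T)).2 inferInstance
  have h3 : a = 𝟙 _ := (cancel_epi a).1 (h2.trans (Category.comp_id _).symm)
  exact ObjectProperty.hom_ext _ h3

/-- **Rigidity of the isotropification functor** (proof of Thm. 3.4 (i), p. 63): for a Frobenioid of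
Frobenius-normalized type over a slim base, the isotropification functor `C → C^istr` of Prop. 1.9 (v)
is rigid. Reduction to Frobenius-trivial objects through Def. 1.3 (i)(a)(b): every object `A` receives a
pre-step from an object `X` which maps by a pre-step to a Frobenius-trivial object over `Base(A)`.
[cite: MochizukiFrdI2008, Thm. 3.4 (i) p.63] -/
theorem isRigidFunctor_isotropification (hF : IsFrobenioid F) (hD : IsSlim D)
    (hFN : (PreFrobenioidData.ofFunctor Φ F).IsOfFrobeniusNormalizedType) :
    IsRigidFunctor (isotropification hF) := by
  intro α
  apply Iso.ext
  apply NatTrans.ext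
  funext A
  -- a Frobenius-trivial `T` over `Base(A)` and a span of pre-steps `A ← X → T`
  obtain ⟨T, hT, ⟨e⟩⟩ := hF.i_a (baseObj F A)
  obtain ⟨X, φ, ψ, -, hψ, -⟩ := hF.i_b A T e.symm
  have hTid := app_eq_id_of_isFrobeniusTrivial_of_iso_isotropification hF hD hFN α hT
  have hXid := app_eq_id_of_isPreStep_of_iso_isotropification hF α hψ hTid
  exact app_eq_id_of_hom_of_iso_isotropification hF α φ hXid

end One

/-! ### The `1`-unique `Ψ^istr` square (Thm. 3.4 (i), diagram part) -/

section Two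

variable {D₁ : Type u} [Category.{v} D₁] {Φ₁ : D₁ᵒᵖ ⥤ CommMonCat.{w}} {C₁ : Type u'}
  [Category.{v'} C₁] {D₂ : Type u} [Category.{v} D₂] {Φ₂ : D₂ᵒᵖ ⥤ CommMonCat.{w}} {C₂ : Type u'}
  [Category.{v'} C₂] {F₁ : C₁ ⥤ ElemFrobenioid Φ₁} {F₂ : C₂ ⥤ ElemFrobenioid Φ₂}

/-- `1`-commutativity at the core: for the restriction `Ψ^istr : C₁^istr ≌ C₂^istr` of an equivalence `Ψ`
between Frobenioids of quasi-isotropic type (Thm. 3.4 (i): `Ψ` preserves isotropic objects),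
`istr₁ ⋙ Ψ^istr ≅ Ψ ⋙ istr₂` — both sides are left adjoint to the same functor `C₂^istr → C₁`
(Prop. 1.9 (v): isotropification ⊣ inclusion). [cite: MochizukiFrdI2008, Thm. 3.4 (i) p.62] -/
theorem nonempty_isotropification_comp_iso (hF₁ : IsFrobenioid F₁) (hF₂ : IsFrobenioid F₂)
    (hq₁ : (PreFrobenioidData.ofFunctor Φ₁ F₁).IsOfQuasiIsotropicType)
    (hq₂ : (PreFrobenioidData.ofFunctor Φ₂ F₂).IsOfQuasiIsotropicType) (Ψ : C₁ ≌ C₂)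
    [(isotropicObjects F₂).IsClosedUnderIsomorphisms] :
    Nonempty (isotropification hF₁ ⋙
        (Ψ.congrFullSubcategory (FrdI.isotropicObjects_inverseImage hF₁ hq₁ hq₂ Ψ)).functor ≅
      Ψ.functor ⋙ isotropification hF₂) := by
  let Ψi := Ψ.congrFullSubcategory (FrdI.isotropicObjects_inverseImage hF₁ hq₁ hq₂ Ψ)
  let adjA : isotropification hF₁ ⋙ Ψi.functor ⊣ Ψi.inverse ⋙ (isotropicObjects F₁).ι :=
    (isotropificationAdjunction hF₁).comp Ψi.toAdjunction
  let adjB : Ψ.functor ⋙ isotropification hF₂ ⊣ (isotropicObjects F₂).ι ⋙ Ψ.inverse :=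
    Ψ.toAdjunction.comp (isotropificationAdjunction hF₂)
  -- the two right adjoints agree on the nose
  let eR : (isotropicObjects F₂).ι ⋙ Ψ.inverse ≅ Ψi.inverse ⋙ (isotropicObjects F₁).ι := Iso.refl _
  exact ⟨adjA.leftAdjointUniq (adjB.ofNatIsoRight eR)⟩

/-- **Thm. 3.4 (i), diagram part, for Frobenioids** — the typed `PreFrobenioidData.Thm34i_istr` at the
operations `ofFunctor Φ_i F_i` and at the isotropification functors of Prop. 1.9 (v) (read in the §3
full subcategory `(ofFunctor Φ F).Istr` through the identity-on-objects functor `ObjectProperty.ιOfLE`):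
there is a `1`-unique `Ψ^istr : C₁^istr ⥤ C₂^istr` (the restriction of `Ψ`) making the square with the
isotropification functors `1`-commute, it is an equivalence, and if `D₁`, `D₂` are slim and `C₁`, `C₂`
of Frobenius-normalized type then both composite functors `C₁ → C₂^istr` are rigid.
[cite: MochizukiFrdI2008, Thm. 3.4 (i) p.62] -/
theorem thm34i_istr_ofFunctor (hF₁ : IsFrobenioid F₁) (hF₂ : IsFrobenioid F₂) (Ψ : C₁ ≌ C₂) :
    (PreFrobenioidData.ofFunctor Φ₁ F₁).Thm34i_istr (PreFrobenioidData.ofFunctor Φ₂ F₂) Ψ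
      (isotropification hF₁ ⋙ ObjectProperty.ιOfLE (isotropicObjects_le_ofFunctor F₁))
      (isotropification hF₂ ⋙ ObjectProperty.ιOfLE (isotropicObjects_le_ofFunctor F₂)) := by
  intro hq₁ hq₂
  have hP₂ := hF₂.isPreFrobenioid
  haveI : (isotropicObjects F₂).IsClosedUnderIsomorphisms :=
    ⟨fun e hX => IsIsotropic.of_iso hP₂ e.symm hX⟩
  -- notation: the identity-on-objects comparisons `J`, `K` and the restriction `Ψi` of `Ψ`
  let J₁ : Istr F₁ ⥤ (PreFrobenioidData.ofFunctor Φ₁ F₁).Istr :=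
    ObjectProperty.ιOfLE (isotropicObjects_le_ofFunctor F₁)
  let J₂ : Istr F₂ ⥤ (PreFrobenioidData.ofFunctor Φ₂ F₂).Istr :=
    ObjectProperty.ιOfLE (isotropicObjects_le_ofFunctor F₂)
  let K₁ : (PreFrobenioidData.ofFunctor Φ₁ F₁).Istr ⥤ Istr F₁ :=
    ObjectProperty.ιOfLE (isotropicObjects_ofFunctor_le F₁)
  let Ψi := Ψ.congrFullSubcategory (FrdI.isotropicObjects_inverseImage hF₁ hq₁ hq₂ Ψ)
  haveI : K₁.IsEquivalence := (ObjectProperty.isEquivalence_ιOfLE_iff _).2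
    (le_trans (isotropicObjects_le_ofFunctor F₁) (ObjectProperty.le_isoClosure _))
  haveI : J₂.IsEquivalence := (ObjectProperty.isEquivalence_ιOfLE_iff _).2
    (le_trans (isotropicObjects_ofFunctor_le F₂) (ObjectProperty.le_isoClosure _))
  -- the core `1`-commutativity and the composite square
  obtain ⟨core⟩ := nonempty_isotropification_comp_iso hF₁ hF₂ hq₁ hq₂ Ψ
  let comm : Ψ.functor ⋙ (isotropification hF₂ ⋙ J₂) ≅
      (isotropification hF₁ ⋙ J₁) ⋙ (K₁ ⋙ Ψi.functor ⋙ J₂) :=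
    Functor.isoWhiskerRight core.symm J₂
  -- "the restriction of the isotropification functor to `C^istr` is isomorphic to the identity"
  let ρ₁ : (PreFrobenioidData.ofFunctor Φ₁ F₁).istrι ⋙ (isotropification hF₁ ⋙ J₁) ≅ 𝟭 _ :=
    Functor.isoWhiskerLeft K₁ (Functor.isoWhiskerRight (isotropificationRestrictIso hF₁) J₁)
  -- every functor making the square `1`-commute is isomorphic to a canonical one
  have canon : ∀ (B : (PreFrobenioidData.ofFunctor Φ₁ F₁).Istr ⥤ (PreFrobenioidData.ofFunctor Φ₂ F₂).Istr),
      (Ψ.functor ⋙ (isotropification hF₂ ⋙ J₂) ≅ (isotropification hF₁ ⋙ J₁) ⋙ B) →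
        Nonempty (B ≅ (PreFrobenioidData.ofFunctor Φ₁ F₁).istrι ⋙ Ψ.functor ⋙ (isotropification hF₂ ⋙ J₂)) :=
    fun B e => ⟨B.leftUnitor.symm ≪≫ Functor.isoWhiskerRight ρ₁.symm B ≪≫ Functor.associator _ _ _ ≪≫
      Functor.isoWhiskerLeft _ e.symm⟩
  refine ⟨K₁ ⋙ Ψi.functor ⋙ J₂, ⟨inferInstance, ⟨comm⟩, fun B' hB' => ?_⟩, fun hD₁ hD₂ hFN₁ hFN₂ => ?_⟩
  · obtain ⟨e'⟩ := hB'
    obtain ⟨c1⟩ := canon B' e'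
    obtain ⟨c2⟩ := canon _ comm
    exact ⟨c1 ≪≫ c2.symm⟩
  · have h₂ : IsRigidFunctor (Ψ.functor ⋙ (isotropification hF₂ ⋙ J₂)) :=
      IsRigidFunctor.equivalence_comp Ψ ((isRigidFunctor_isotropification hF₂ hD₂ hFN₂).comp_fullyFaithful J₂)
    exact ⟨h₂, h₂.of_iso comm⟩

end Two

end PreFrobenioid

end Literature.AlgebraicGeometry.Frobenioids
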